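import Mathlib
import Literature.RepresentationTheory.FiniteGroups.InducedClassFunction
import Literature.RepresentationTheory.FiniteGroups.BrauerInduction
import Literature.RepresentationTheory.FiniteGroups.IrreducibleCharacters
import Literature.RepresentationTheory.FiniteGroups.RepresentationRing
import Summits.MatrixMultiplication.MatrixMultiplication.Theorems.SubgroupIdentityDesigns.Negative.ParabolicSubgroup
import Summits.MatrixMultiplication.MatrixMultiplication.Theorems.SubgroupIdentityDesigns.Negative.ParabolicRestriction

/-!
# The Steinberg tower of `GL_a(F)` and the truncated alternating sums `Σ_{c<m} (−1)^{m−1−c} I_c St_c`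

Supports stmt-MatrixMultiplication-14079 (route `LevelGradedCohnUmans`, crux `SubgroupIdentityDesigns`).
VALUE = theorem, NOT summit progress.  CONDITIONAL layer: every statement below that mentions
`MackeyFormula` takes the Mackey formula for two maximal parabolic subgroups of `GL_N(F)` as a
hypothesis (stated here as a `Prop`; its proof is the subject of the sequel `ParabolicMackey`).

* `MackeyFormula F N` — for class functions `σ` on `GL_c`, `τ` on `GL_j` (`c, j ≤ N`):
  `⟨I^N_c σ, I^N_j τ⟩_{GL_N} = Σ_{i ≤ min(c,j), c+j ≤ N+i} ⟨r^c_i σ, r^j_i τ⟩_{GL_i}`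
  (the `(P_c, P_j)` double cosets of `GL_N` are indexed by `i = dim (V_c ∩ g V_j)`; Zelevinsky,
  LNM 869, §9–§10 ("PSH-algebra of `GL`"); Green 1955; Springer, LNM 131, 3.7);
* `steinberg a = St_a` — the Solomon–Tits / Curtis alternating-sum recursion `St_0 = 1`,
  `St_{a} = Σ_{c<a} (−1)^{a−1−c} I^a_c St_c` (Curtis 1966, Steinberg 1951);
* `trunc N m = Σ_{c<m} (−1)^{m−1−c} I^N_c St_c` (`m ≤ N`): `St_N = trunc N N` (`N ≥ 1`), and for
  `N = k + l`, `m = k + 1` this is the **hook unipotent character** `χ^{(l,1^k)}`;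
* `steinberg_mem_virtChars`, `trunc_mem_virtChars` — virtual characters (`indClassFun_mem_virtChars`);
* `classInner_trunc_hcInd` — **(conditional on Mackey)** for `j < m ≤ N` and a class function `τ`:
  `⟨trunc N m, I^N_j τ⟩ = [j + 1 = m] ⟨St_j, τ⟩` (telescoping of the two surviving Mackey terms);
* `classInner_steinberg_steinberg` — `⟨St_a, St_a⟩ = 1`; `classInner_trunc_trunc` — `⟨trunc N m,
  trunc N m⟩ = 1` for `1 ≤ m ≤ N` (so the hook character is `±` an irreducible character).
-/

set_option linter.dupNamespace false

noncomputable section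

open scoped BigOperators Matrix Classical
open Literature.RepresentationTheory.FiniteGroups

namespace Summit.MatrixMultiplication.MatrixMultiplication.Theorems.SubgroupIdentityDesigns.Negative
namespace SteinbergTower

open ParabolicSubgroup ParabolicRestriction

section General

variable {G : Type} [Group G]

/-- Constant functions are class functions. -/
theorem isClassFun_const (z : ℂ) : IsClassFun (fun _ : G => z) := fun _ _ => rfl

/-- Sums of class functions. -/
theorem isClassFun_add {φ ψ : G → ℂ} (hφ : IsClassFun φ) (hψ : IsClassFun ψ) : IsClassFun (φ + ψ) :=
  fun s t => by simp only [Pi.add_apply, hφ s t, hψ s t]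

/-- Scalar multiples of class functions. -/
theorem isClassFun_smul (r : ℂ) {φ : G → ℂ} (hφ : IsClassFun φ) : IsClassFun (r • φ) :=
  fun s t => by simp only [Pi.smul_apply, hφ s t]

/-- Finite sums of class functions. -/
theorem isClassFun_sum {ι : Type} (S : Finset ι) {φ : ι → G → ℂ} (h : ∀ i ∈ S, IsClassFun (φ i)) :
    IsClassFun (∑ i ∈ S, φ i) := by
  induction S using Finset.induction_on with
  | empty => rw [Finset.sum_empty]; exact fun _ _ => rfl
  | insert i S hi ih =>
    rw [Finset.sum_insert hi]
    exact isClassFun_add (h i (Finset.mem_insert_self _ _))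
      (ih fun i' hi' => h i' (Finset.mem_insert_of_mem hi'))

/-- The pull-back of a character along a group homomorphism is a character. -/
theorem isCharacter_comp {P L : Type} [Group P] [Group L] (π : P →* L) {χ : L → ℂ}
    (hχ : IsCharacter L χ) : IsCharacter P (fun p => χ (π p)) := by
  obtain ⟨V, _, _, _, ρ, rfl⟩ := hχ
  exact ⟨V, inferInstance, inferInstance, inferInstance, ρ.comp π, rfl⟩

/-- **Inflation preserves virtual characters**: `f ∈ R(L) ⇒ f ∘ π ∈ R(P)`. -/
theorem comp_mem_virtChars {P L : Type} [Group P] [Group L] [Fintype P] [Fintype L]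
    [DecidableEq P] [DecidableEq L] (π : P →* L) {f : L → ℂ} (hf : f ∈ virtChars L) :
    (fun p => f (π p)) ∈ virtChars P := by
  rw [mem_virtChars] at hf ⊢
  refine AddSubgroup.closure_induction (p := fun f _ => (fun p => f (π p)) ∈
    AddSubgroup.closure (irrChars P)) ?_ ?_ ?_ ?_ hf
  · intro χ hχ
    exact (isCharacter_comp π (IsIrrChar.isCharacter hχ)).mem_virtChars
  · exact AddSubgroup.zero_mem _
  · intro x y _ _ hx hy
    exact AddSubgroup.add_mem _ hx hy
  · intro x _ hx
    exact AddSubgroup.neg_mem _ hx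

/-- `(−1)^m • f ∈ R(G)` for `f ∈ R(G)`. -/
theorem neg_one_pow_smul_mem_virtChars [Fintype G] [DecidableEq G] (m : ℕ) {f : G → ℂ}
    (hf : f ∈ virtChars G) : (-1 : ℂ) ^ m • f ∈ virtChars G := by
  rcases neg_one_pow_eq_or ℂ m with h | h
  · rw [h, one_smul]; exact hf
  · rw [h, neg_one_smul]; exact neg_mem hf

end General

variable {F : Type} [Field F] [Fintype F] [DecidableEq F]

/-- `I^a_c` maps `R(GL_c)` into `R(GL_a)` (inflation then `indClassFun_mem_virtChars`). -/
theorem hcInd_mem_virtChars {a c : ℕ} (hc : c ≤ a) {σ : GL (Fin c) F → ℂ}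
    (hσ : σ ∈ virtChars (GL (Fin c) F)) : hcInd hc σ ∈ virtChars (GL (Fin a) F) :=
  indClassFun_mem_virtChars _ (comp_mem_virtChars (ul hc) hσ)

/-- **The Mackey formula for two maximal parabolic subgroups of `GL_N(F)`** (as a `Prop`): for
class functions `σ` on `GL_c(F)` and `τ` on `GL_j(F)`,
`⟨I^N_c σ, I^N_j τ⟩ = Σ_{i = max(0, c+j−N)}^{min(c,j)} ⟨r^c_i σ, r^j_i τ⟩_{GL_i}`. -/
def MackeyFormula (F : Type) [Field F] [Fintype F] [DecidableEq F] (N : ℕ) : Prop :=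
  ∀ (c j : ℕ) (hc : c ≤ N) (hj : j ≤ N) (σ : GL (Fin c) F → ℂ) (τ : GL (Fin j) F → ℂ),
    IsClassFun σ → IsClassFun τ →
      classInner (hcInd hc σ) (hcInd hj τ) =
        ∑ i : Fin (min c j + 1), if c + j ≤ N + (i : ℕ) then
          classInner (hcRes ((Fin.is_le i).trans (min_le_left c j)) σ)
            (hcRes ((Fin.is_le i).trans (min_le_right c j)) τ) else 0

/-- **`St_a`**, the Steinberg character of `GL_a(F)`, by the alternating-sum recursion
`St_0 = 1`, `St_{a+1} = Σ_{c ≤ a} (−1)^{a−c} I^{a+1}_c St_c`. -/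
def steinberg : (a : ℕ) → (GL (Fin a) F → ℂ)
  | 0 => fun _ => 1
  | a + 1 => ∑ c : Fin (a + 1), (-1 : ℂ) ^ (a - (c : ℕ)) • hcInd (F := F) (le_of_lt c.2) (steinberg c)
  termination_by a => a
  decreasing_by exact c.2

/-- **`trunc N m = Σ_{c<m} (−1)^{m−1−c} I^N_c St_c`** (`m ≤ N`). -/
def trunc (N m : ℕ) (hm : m ≤ N) : GL (Fin N) F → ℂ :=
  ∑ c : Fin m, (-1 : ℂ) ^ (m - 1 - (c : ℕ)) • hcInd ((le_of_lt c.2).trans hm) (steinberg c)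

/-- `St_0 = 1`. -/
theorem steinberg_zero : (steinberg 0 : GL (Fin 0) F → ℂ) = fun _ => 1 := by
  rw [steinberg]

/-- `St_{a+1} = trunc (a+1) (a+1)`. -/
theorem steinberg_succ (a : ℕ) : (steinberg (a + 1) : GL (Fin (a + 1)) F → ℂ) = trunc (a + 1) (a + 1) le_rfl := by
  rw [steinberg, trunc]
  simp only [Nat.add_sub_cancel]

/-- `St_a = trunc a a` for `a ≥ 1`. -/
theorem steinberg_eq_trunc {a : ℕ} (ha : 0 < a) : (steinberg a : GL (Fin a) F → ℂ) = trunc a a le_rfl := by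
  obtain ⟨b, rfl⟩ := Nat.exists_eq_succ_of_ne_zero ha.ne'
  exact steinberg_succ b

/-- `St_a` is a class function. -/
theorem isClassFun_steinberg (a : ℕ) : IsClassFun (steinberg a : GL (Fin a) F → ℂ) := by
  rcases a with _ | a
  · rw [steinberg_zero]; exact isClassFun_const 1
  · rw [steinberg_succ, trunc]
    exact isClassFun_sum _ fun _ _ => isClassFun_smul _ (isClassFun_hcInd _ _)

/-- `trunc N m` is a class function. -/
theorem isClassFun_trunc {N m : ℕ} (hm : m ≤ N) : IsClassFun (trunc (F := F) N m hm) :=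
  isClassFun_sum _ fun _ _ => isClassFun_smul _ (isClassFun_hcInd _ _)

/-- **`St_a ∈ R(GL_a)`**: the Steinberg function is a virtual character. -/
theorem steinberg_mem_virtChars (a : ℕ) : (steinberg a : GL (Fin a) F → ℂ) ∈ virtChars (GL (Fin a) F) := by
  induction a using Nat.strong_induction_on with
  | _ a ih =>
    rcases a with _ | a
    · rw [steinberg_zero]
      exact (virtChars (GL (Fin 0) F)).one_mem
    · rw [steinberg_succ, trunc]
      refine Subring.sum_mem _ fun c _ => ?_
      exact neg_one_pow_smul_mem_virtChars _ (hcInd_mem_virtChars _ (ih c c.2))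

/-- `trunc N m ∈ R(GL_N)`. -/
theorem trunc_mem_virtChars {N m : ℕ} (hm : m ≤ N) : trunc (F := F) N m hm ∈ virtChars (GL (Fin N) F) :=
  Subring.sum_mem _ fun c _ =>
    neg_one_pow_smul_mem_virtChars _ (hcInd_mem_virtChars _ (steinberg_mem_virtChars c))

/-- `⟨St_0, St_0⟩ = 1`. -/
theorem classInner_steinberg_zero :
    classInner (steinberg 0 : GL (Fin 0) F → ℂ) (steinberg 0) = 1 := by
  rw [steinberg_zero, classInner_apply]
  simp only [mul_one, Finset.sum_const, Finset.card_univ, nsmul_eq_mul]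
  exact inv_mul_cancel₀ (Nat.cast_ne_zero.mpr Fintype.card_ne_zero)

/-- The pairings `A_i = [i ≤ j] ⟨St_i, r^j_i τ⟩` that survive in the Mackey expansion. -/
def pairA (j : ℕ) (τ : GL (Fin j) F → ℂ) (i : ℕ) : ℂ :=
  if h : i ≤ j then classInner (steinberg i) (hcRes h τ) else 0

/-- Index transport for the pairings (the index enters through types). -/
theorem pairA_aux {j : ℕ} (τ : GL (Fin j) F → ℂ) (x y : ℕ) (hx : x ≤ j) (hy : y ≤ j) (e : x = y) :
    classInner (steinberg x) (hcRes hx τ) = classInner (steinberg y) (hcRes hy τ) := by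
  subst e
  rfl

/-- Index transport for `⟨St_x, St_x⟩`. -/
theorem steinberg_norm_aux (x y : ℕ) (e : x = y) :
    classInner (steinberg x : GL (Fin x) F → ℂ) (steinberg x) =
      classInner (steinberg y : GL (Fin y) F → ℂ) (steinberg y) := by
  subst e
  rfl

/-- One Mackey term: for `c, j ≤ N` with `j + 1 ≤ N`, given the recursion for all `St_{c'}`,
`c' ≤ c`: `⟨I^N_c St_c, I^N_j τ⟩ = A_c + [1 ≤ c] A_{c−1}`. -/
theorem mackey_term {N c j : ℕ} (hM : MackeyFormula F N) (hc : c ≤ N) (hj : j ≤ N) (hjN : j + 1 ≤ N)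
    (hrec : ∀ (i : ℕ) (hic : i < c) (ρ : GL (Fin i) F → ℂ), IsClassFun ρ →
      classInner (steinberg c) (hcInd (le_of_lt hic) ρ) =
        if i + 1 = c then classInner (steinberg i) ρ else 0)
    {τ : GL (Fin j) F → ℂ} (hτ : IsClassFun τ) :
    classInner (hcInd hc (steinberg c)) (hcInd hj τ) =
      pairA j τ c + if 1 ≤ c then pairA j τ (c - 1) else 0 := by
  rw [hM c j hc hj _ _ (isClassFun_steinberg c) hτ]
  -- evaluate each term of the Mackey sum
  have hterm : ∀ i : Fin (min c j + 1),
      (if c + j ≤ N + (i : ℕ) then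
        classInner (hcRes ((Fin.is_le i).trans (min_le_left c j)) (steinberg c))
          (hcRes ((Fin.is_le i).trans (min_le_right c j)) τ) else 0) =
      (if (i : ℕ) = c then pairA j τ c else 0) +
        (if (i : ℕ) + 1 = c then pairA j τ (c - 1) else 0) := by
    intro i
    have hic : (i : ℕ) ≤ c := (Fin.is_le i).trans (min_le_left c j)
    have hij : (i : ℕ) ≤ j := (Fin.is_le i).trans (min_le_right c j)
    by_cases hcond : c + j ≤ N + (i : ℕ)
    swap
    · -- the term vanishes, and so do both indicator terms (`i + 2 ≤ c`)
      rw [if_neg hcond, if_neg (by omega), if_neg (by omega), add_zero]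
    rw [if_pos hcond, ← classInner_hcInd_right hic (isClassFun_steinberg c) _]
    rcases Nat.lt_or_ge (i : ℕ) c with hlt | hge
    · -- `i < c`: the recursion for `St_c`
      rw [hrec i hlt _ (isClassFun_hcRes _ hτ), if_neg (Nat.ne_of_lt hlt), zero_add]
      by_cases h1 : (i : ℕ) + 1 = c
      · rw [if_pos h1, if_pos h1, pairA, dif_pos (by omega)]
        exact pairA_aux τ _ _ _ _ (by omega)
      · rw [if_neg h1, if_neg h1]
    · -- `i = c`
      have heq : (i : ℕ) = c := le_antisymm hic hge
      rw [if_pos heq, if_neg (by omega), add_zero, pairA, dif_pos (heq ▸ hij)]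
      -- `I^c_c ρ = ρ`
      have key : ∀ (x : ℕ) (hx : x = c) (h : x ≤ c) (h' : x ≤ j),
          classInner (steinberg c) (hcInd h (hcRes h' τ)) = classInner (steinberg c) (hcRes (hx ▸ h') τ) := by
        intro x hx h h'
        subst hx
        rw [hcInd_self (isClassFun_hcRes _ hτ)]
      exact key i heq hic hij
  rw [Finset.sum_congr rfl fun i _ => hterm i, Finset.sum_add_distrib]
  -- the two sums over `Fin (min c j + 1)` are supported on one point each
  rw [Fin.sum_univ_eq_sum_range (fun i => if i = c then pairA j τ c else 0),
    Fin.sum_univ_eq_sum_range (fun i => if i + 1 = c then pairA j τ (c - 1) else 0)]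
  congr 1
  · rw [Finset.sum_ite_eq' (Finset.range (min c j + 1)) c]
    by_cases h : c ∈ Finset.range (min c j + 1)
    · rw [if_pos h]
    · rw [if_neg h, pairA, dif_neg]
      intro h'
      apply h
      rw [Finset.mem_range]
      omega
  · by_cases h1 : 1 ≤ c
    · rw [if_pos h1]
      have hre : ∀ i ∈ Finset.range (min c j + 1),
          (if i + 1 = c then pairA j τ (c - 1) else 0) = if i = c - 1 then pairA j τ (c - 1) else 0 := by
        intro i _
        by_cases h : i + 1 = c
        · rw [if_pos h, if_pos (by omega)]
        · rw [if_neg h, if_neg (by omega)]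
      rw [Finset.sum_congr rfl hre, Finset.sum_ite_eq' (Finset.range (min c j + 1)) (c - 1)]
      by_cases h : c - 1 ∈ Finset.range (min c j + 1)
      · rw [if_pos h]
      · rw [if_neg h, pairA, dif_neg]
        intro h'
        apply h
        rw [Finset.mem_range]
        omega
    · rw [if_neg h1]
      refine Finset.sum_eq_zero fun i _ => ?_
      rw [if_neg]
      omega

/-- **Telescoping**: `Σ_{c<m} (−1)^{m−1−c} (A_c + [1 ≤ c] A_{c−1}) = A_{m−1}` (`m ≥ 1`). -/
theorem telescope (A : ℕ → ℂ) {m : ℕ} (hm : 1 ≤ m) :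
    ∑ c ∈ Finset.range m, (-1 : ℂ) ^ (m - 1 - c) * (A c + if 1 ≤ c then A (c - 1) else 0) =
      A (m - 1) := by
  -- `f c = (−1)^{m−c} A_{c−1}` for `c ≥ 1`, `f 0 = 0`; the summand is `f (c+1) − f c`
  set f : ℕ → ℂ := fun c => if 1 ≤ c then (-1 : ℂ) ^ (m - c) * A (c - 1) else 0 with hf
  have hsummand : ∀ c ∈ Finset.range m,
      (-1 : ℂ) ^ (m - 1 - c) * (A c + if 1 ≤ c then A (c - 1) else 0) = f (c + 1) - f c := by
    intro c hc
    rw [Finset.mem_range] at hc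
    simp only [hf]
    rw [if_pos (by omega : 1 ≤ c + 1), Nat.add_sub_cancel, show m - (c + 1) = m - 1 - c by omega]
    by_cases h1 : 1 ≤ c
    · rw [if_pos h1, if_pos h1]
      have hpow : (-1 : ℂ) ^ (m - c) = -(-1 : ℂ) ^ (m - 1 - c) := by
        rw [show m - c = (m - 1 - c) + 1 by omega, pow_succ]
        ring
      rw [hpow]
      ring
    · rw [if_neg h1, if_neg h1]
      ring
  rw [Finset.sum_congr rfl hsummand, Finset.sum_range_sub]
  simp only [hf]
  rw [if_pos hm, if_neg (by omega), sub_zero, Nat.sub_self, pow_zero, one_mul]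

/-- **The key recursion (conditional on Mackey).**  For `j < m ≤ N`, a class function `τ` on
`GL_j(F)`, and the Mackey formula on all `GL_{N'}`, `N' ≤ N`:
`⟨trunc N m, I^N_j τ⟩_{GL_N} = [j + 1 = m] · ⟨St_j, τ⟩_{GL_j}`.
In particular (`m = N = a`): `⟨St_a, I^a_j τ⟩ = [j = a − 1] ⟨St_{a−1}, τ⟩` — the Steinberg
character pairs trivially with everything parabolically induced except through the top step. -/
theorem classInner_trunc_hcInd {N : ℕ} (hM : ∀ N', N' ≤ N → MackeyFormula F N') {m j : ℕ}
    (hm : m ≤ N) (hjm : j < m) {τ : GL (Fin j) F → ℂ} (hτ : IsClassFun τ) :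
    classInner (trunc N m hm) (hcInd ((le_of_lt hjm).trans hm) τ) =
      if j + 1 = m then classInner (steinberg j) τ else 0 := by
  induction N using Nat.strong_induction_on generalizing m j with
  | _ N ih =>
    -- the recursion for every `St_c`, `c < N`, from the induction hypothesis
    have hrec : ∀ (c : ℕ), c < N → ∀ (i : ℕ) (hic : i < c) (ρ : GL (Fin i) F → ℂ), IsClassFun ρ →
        classInner (steinberg c) (hcInd (le_of_lt hic) ρ) =
          if i + 1 = c then classInner (steinberg i) ρ else 0 := by
      intro c hcN i hic ρ hρ
      have hc0 : 0 < c := by omega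
      rw [steinberg_eq_trunc hc0]
      exact ih c hcN (fun N' hN' => hM N' (hN'.trans hcN.le)) le_rfl hic hρ
    rw [trunc, classInner_sum_left]
    have hjN : j + 1 ≤ N := by omega
    have hterm : ∀ c : Fin m,
        classInner ((-1 : ℂ) ^ (m - 1 - (c : ℕ)) • hcInd ((le_of_lt c.2).trans hm) (steinberg c))
          (hcInd ((le_of_lt hjm).trans hm) τ) =
        (-1 : ℂ) ^ (m - 1 - (c : ℕ)) * (pairA j τ c + if 1 ≤ (c : ℕ) then pairA j τ (c - 1) else 0) := by
      intro c
      rw [classInner_smul_left, mackey_term (hM N le_rfl) _ _ hjN (hrec c (by omega)) hτ]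
    rw [Finset.sum_congr rfl fun c _ => hterm c,
      Fin.sum_univ_eq_sum_range (fun c => (-1 : ℂ) ^ (m - 1 - c) *
        (pairA j τ c + if 1 ≤ c then pairA j τ (c - 1) else 0)),
      telescope _ (by omega : 1 ≤ m), pairA]
    by_cases h : j + 1 = m
    · subst h
      rw [if_pos rfl, Nat.add_sub_cancel, dif_pos le_rfl, hcRes_self]
    · rw [if_neg h, dif_neg (by omega)]

/-- **`⟨St_a, I^a_j τ⟩ = [j + 1 = a] ⟨St_j, τ⟩`** for `j < a` and a class function `τ`
(conditional on Mackey up to `GL_a`). -/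
theorem classInner_steinberg_hcInd {a : ℕ} (hM : ∀ N', N' ≤ a → MackeyFormula F N') {j : ℕ}
    (hja : j < a) {τ : GL (Fin j) F → ℂ} (hτ : IsClassFun τ) :
    classInner (steinberg a) (hcInd (le_of_lt hja) τ) =
      if j + 1 = a then classInner (steinberg j) τ else 0 := by
  rw [steinberg_eq_trunc (by omega : 0 < a)]
  exact classInner_trunc_hcInd hM le_rfl hja hτ

/-- **`⟨trunc N m, trunc N m⟩ = ⟨St_{m−1}, St_{m−1}⟩`** for `1 ≤ m ≤ N` (conditional on Mackey). -/
theorem classInner_trunc_trunc_eq {N : ℕ} (hM : ∀ N', N' ≤ N → MackeyFormula F N') {m : ℕ}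
    (hm : m ≤ N) (h1 : 1 ≤ m) :
    classInner (trunc (F := F) N m hm) (trunc N m hm) =
      classInner (steinberg (m - 1) : GL (Fin (m - 1)) F → ℂ) (steinberg (m - 1)) := by
  have hexp : classInner (trunc (F := F) N m hm) (trunc N m hm) =
      ∑ c : Fin m, classInner ((-1 : ℂ) ^ (m - 1 - (c : ℕ)) •
        hcInd ((le_of_lt c.2).trans hm) (steinberg c)) (trunc (F := F) N m hm) := by
    rw [← classInner_sum_left]
    rfl
  rw [hexp]
  have hterm : ∀ c : Fin m,
      classInner ((-1 : ℂ) ^ (m - 1 - (c : ℕ)) • hcInd ((le_of_lt c.2).trans hm) (steinberg c))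
        (trunc (F := F) N m hm) =
      if (c : ℕ) + 1 = m then classInner (steinberg (m - 1) : GL (Fin (m - 1)) F → ℂ) (steinberg (m - 1))
        else 0 := by
    intro c
    rw [classInner_smul_left, classInner_comm,
      classInner_trunc_hcInd hM hm c.2 (isClassFun_steinberg c)]
    by_cases h : (c : ℕ) + 1 = m
    · rw [if_pos h, if_pos h]
      rw [show m - 1 - (c : ℕ) = 0 by omega, pow_zero, one_mul]
      exact steinberg_norm_aux _ _ (by omega)
    · rw [if_neg h, if_neg h, mul_zero]
  rw [Finset.sum_congr rfl fun c _ => hterm c,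
    Fin.sum_univ_eq_sum_range (fun c => if c + 1 = m then
      classInner (steinberg (m - 1) : GL (Fin (m - 1)) F → ℂ) (steinberg (m - 1)) else 0)]
  have hre : ∀ c ∈ Finset.range m, (if c + 1 = m then
      classInner (steinberg (m - 1) : GL (Fin (m - 1)) F → ℂ) (steinberg (m - 1)) else 0) =
      if c = m - 1 then classInner (steinberg (m - 1) : GL (Fin (m - 1)) F → ℂ) (steinberg (m - 1)) else 0 := by
    intro c _
    by_cases h : c + 1 = m
    · rw [if_pos h, if_pos (by omega)]
    · rw [if_neg h, if_neg (by omega)]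
  rw [Finset.sum_congr rfl hre, Finset.sum_ite_eq']
  rw [if_pos (Finset.mem_range.mpr (by omega))]

/-- **`⟨St_a, St_a⟩ = 1`** (conditional on Mackey up to `GL_a`): the Steinberg function is `±` an
irreducible character. -/
theorem classInner_steinberg_steinberg {a : ℕ} (hM : ∀ N', N' ≤ a → MackeyFormula F N') :
    classInner (steinberg a : GL (Fin a) F → ℂ) (steinberg a) = 1 := by
  induction a with
  | zero => exact classInner_steinberg_zero
  | succ a ih =>
    rw [steinberg_succ, classInner_trunc_trunc_eq hM le_rfl (by omega), Nat.add_sub_cancel]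
    exact ih fun N' hN' => hM N' (by omega)

/-- **`⟨trunc N m, trunc N m⟩ = 1`** for `1 ≤ m ≤ N` (conditional on Mackey up to `GL_N`). -/
theorem classInner_trunc_trunc {N : ℕ} (hM : ∀ N', N' ≤ N → MackeyFormula F N') {m : ℕ}
    (hm : m ≤ N) (h1 : 1 ≤ m) : classInner (trunc (F := F) N m hm) (trunc N m hm) = 1 := by
  rw [classInner_trunc_trunc_eq hM hm h1]
  exact classInner_steinberg_steinberg fun N' hN' => hM N' (by omega)

end SteinbergTower
end Summit.MatrixMultiplication.MatrixMultiplication.Theorems.SubgroupIdentityDesigns.Negative
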